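import Summits.HodgeConjecture.CorCM.IrreducibleOddWeightsIndexParityShadowPair
import HarnessLib

/-!
# Shadow modules: two IRREDUCIBLE shadow modules interact iff an EQUIVARIANT map carries one shadow to the other —
# the criterion of gen 55 (one common irreducible slot) for DIFFERENT slots and pivots; DEFECT QUANTISATION
# `dim Hg(A₀)+dim Hg(A₁)−dim Hg(A₀×A₁) ∈ {0, dim A₀}`

COR-CM (cell `pub-hodgecm2`, binder seat `b16` gen 69, count-neutral claim ROW SPACES OVER THE COMMUTANT, file Q3 —
abstract `G`-set level, in the lane's own language (no bundled representation); theorems only, no definition, no named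
fact, no `sorry`).  NEW as stated, hence under `Summits/`.  HONEST FRAMING: linear algebra of translates of functions
on finite `G`-sets (two irreducible submodules of `ℚ^G` sharing a vector coincide), with its consequence for the
Kubota–Dodson rank of a pair of CM types through gen 68's two-sided shadow formula; `HC_CM` is neither used nor asserted.

SETTING.  `G` acts on finite sets `Y₀, Y₁` (the pivots of two slots, e.g. `Hom(T_κ, ℂ)` for subfields `T_κ` containing
the traces).  For `w : Y → ℚ` the SHADOW-COEFFICIENT SPACE is `S(w) = span{g ↦ w(g·y) : y ∈ Y} ≤ ℚ^G` and the
TRANSLATE MODULE `M(w) = span{y ↦ w(g·y) : g ∈ G} ≤ ℚ^Y`.  `A ≤ ℚ^Y` STABLE (`f ∈ A ⟹ f(k·) ∈ A`) and IRREDUCIBLE (no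
stable `0 ≠ W < A`) — the lane's (IRR) shape of gen 55, e.g. `A = Anti` the odd weights of a CM field with (IRR).

* §1 `dim M(w) = dim S(w)` (row rank = column rank, `finrank_span_translate_eq_finrank_span_shadowCoeff`); `M(w) = A`
  for `0 ≠ w ∈ A` irreducible (`span_translate_eq_of_irreducible`), so **`dim S(w) = dim A`**; an equivariant `L` with
  `L w₁ = w₀` gives **`S(w₀) ≤ S(w₁)`** (`span_shadowCoeff_le_of_map`).
* §2 **THE MEET THEOREM** (`exists_map_of_span_shadowCoeff_inf_ne_bot`): `w_κ ∈ A_κ` stable irreducible,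
  `S(w₀) ∩ S(w₁) ≠ 0` ⟹ there is a linear `L : ℚ^{Y₁} → ℚ^{Y₀}`, EQUIVARIANT and INJECTIVE on `A₁`, with `L(A₁) ⊆ A₀`
  and **`L w₁ = w₀`** (proof: the coefficient maps `Θ_κ f = (g ↦ Σ_y α_κ(y) f(g·y))` with `Θ_κ w_κ = c` are injective on
  `A_κ` by irreducibility, their images are irreducible submodules of `ℚ^G` sharing `c ≠ 0`, hence EQUAL;
  `L = Θ₀⁻¹ ∘ Θ₁`).  With §1: **`S(w₀) ∩ S(w₁) ≠ 0 ⟺ S(w₀) = S(w₁) ≠ 0 ⟺ w₀ = L w₁ ≠ 0` for an `A₁ → A₀` equivariant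
  isomorphism** (`span_shadowCoeff_inf_eq_bot_or_eq`, `span_shadowCoeff_inf_ne_bot_iff`); in particular
  `dim(S(w₀) ∩ S(w₁)) ∈ {0, dim A₀}` and a non-zero meet forces `dim A₀ = dim A₁`
  (`finrank_span_shadowCoeff_inf_eq_zero_or_eq`, `finrank_eq_finrank_of_span_shadowCoeff_inf_ne_bot`).
* §3 (file Q3b `IrreducibleOddWeightsShadowModulesDefect`) turns this into DEFECT QUANTISATION for type ranks:
  `rank Φ₀ + rank Φ₁ − rank(Φ₀,Φ₁) − 1 ∈ {0, dim A₀}`, non-zero IFF an equivariant `L` carries shadow to shadow — gen 55's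
  criterion «additive iff no equivariant `L` with `L u₁ = u₀`» (one common irreducible slot) for DIFFERENT fields, read
  on the shadows.  No model, no absolute irreducibility: the commutant is whatever it is.

## References

* [Gordon1999HodgeAVSurvey] B. B. Gordon, *A survey of the Hodge conjecture for abelian varieties*, §3 Theorem (proof),
  7.5–7.7, 9.4.3.
* [Serre1977] J.-P. Serre, *Linear Representations of Finite Groups*, GTM 42, §2.2 (Schur), §2.6 (canonical decomposition).
* [Lang2002] S. Lang, *Algebra*, 3rd ed., XVII §1 Prop. 1.1, XVII §3.
* [Deligne1982HodgeCycles] P. Deligne, *Hodge cycles on abelian varieties*, LNM 900, I §3 Ex. 3.7.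
-/

set_option autoImplicit false

noncomputable section

open scoped BigOperators Classical

universe u v v' v'' w

namespace Summit.HodgeConjecture.CorCM.IrrOdd

open Literature.NumberTheory.ComplexMultiplication

variable {G : Type w} [Group G] {Y₀ : Type v'} [MulAction G Y₀] [Fintype Y₀] [DecidableEq Y₀]
  {Y₁ : Type v''} [MulAction G Y₁] [Fintype Y₁] [DecidableEq Y₁]

/-! ### §1 Translate module versus shadow-coefficient space -/

omit [DecidableEq Y₀] in
/-- **`dim M(w) = dim S(w)`**: the translates `y ↦ w(g·y)` and the shadow coefficients `g ↦ w(g·y)` are the rows and the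
columns of one matrix. [cite: Deligne1982HodgeCycles, I §3 Ex. 3.7] -/
theorem finrank_span_translate_eq_finrank_span_shadowCoeff (w : Y₀ → ℚ) :
    Module.finrank ℚ (Submodule.span ℚ (Set.range fun g : G => fun y : Y₀ => w (g • y))) =
      Module.finrank ℚ (Submodule.span ℚ (Set.range fun y : Y₀ => fun g : G => w (g • y))) :=
  finrank_span_range_eq_finrank_span_range_swap (fun (g : G) (y : Y₀) => w (g • y))

omit [Fintype Y₀] [DecidableEq Y₀] in
/-- A translate of an element of the translate module is in the translate module. [cite: Serre1977, §2.2] -/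
theorem translate_mem_span_translate (w : Y₀ → ℚ) (k : G) {f : Y₀ → ℚ}
    (hf : f ∈ Submodule.span ℚ (Set.range fun g : G => fun y : Y₀ => w (g • y))) :
    (fun y => f (k • y)) ∈ Submodule.span ℚ (Set.range fun g : G => fun y : Y₀ => w (g • y)) := by
  have hmap := (Submodule.map_span_le (LinearMap.funLeft ℚ ℚ (fun y : Y₀ => k • y))
    (Set.range fun g : G => fun y : Y₀ => w (g • y))
    (Submodule.span ℚ (Set.range fun g : G => fun y : Y₀ => w (g • y)))).2 (by
      rintro _ ⟨g, rfl⟩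
      exact Submodule.subset_span ⟨g * k, funext fun y => by simp [LinearMap.funLeft_apply, mul_smul]⟩)
  exact hmap (Submodule.mem_map_of_mem hf)

omit [Fintype Y₀] [DecidableEq Y₀] in
/-- **`M(w) = A`** for a non-zero `w` in a stable irreducible `A`. [cite: Serre1977, §2.2] -/
theorem span_translate_eq_of_irreducible {A : Submodule ℚ (Y₀ → ℚ)}
    (hAst : ∀ (k : G) (a : Y₀ → ℚ), a ∈ A → (fun y => a (k • y)) ∈ A)
    (hirr : ∀ W : Submodule ℚ (Y₀ → ℚ), W ≤ A → W ≠ ⊥ →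
      (∀ (k : G) (f : Y₀ → ℚ), f ∈ W → (fun y => f (k • y)) ∈ W) → W = A)
    {w : Y₀ → ℚ} (hw : w ∈ A) (hw0 : w ≠ 0) :
    Submodule.span ℚ (Set.range fun g : G => fun y : Y₀ => w (g • y)) = A := by
  refine hirr _ (Submodule.span_le.2 ?_) (fun h => hw0 ?_) (fun k f hf => translate_mem_span_translate w k hf)
  · rintro _ ⟨g, rfl⟩
    exact hAst g w hw
  · have hmem : w ∈ Submodule.span ℚ (Set.range fun g : G => fun y : Y₀ => w (g • y)) :=
      Submodule.subset_span ⟨1, funext fun y => by simp⟩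
    rw [h] at hmem
    exact (Submodule.mem_bot ℚ).1 hmem

omit [DecidableEq Y₀] in
/-- **`dim S(w) = dim A`** for a non-zero `w` in a stable irreducible `A`. [cite: Serre1977, §2.2 and §2.6] -/
theorem finrank_span_shadowCoeff_eq_of_irreducible {A : Submodule ℚ (Y₀ → ℚ)}
    (hAst : ∀ (k : G) (a : Y₀ → ℚ), a ∈ A → (fun y => a (k • y)) ∈ A)
    (hirr : ∀ W : Submodule ℚ (Y₀ → ℚ), W ≤ A → W ≠ ⊥ →
      (∀ (k : G) (f : Y₀ → ℚ), f ∈ W → (fun y => f (k • y)) ∈ W) → W = A)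
    {w : Y₀ → ℚ} (hw : w ∈ A) (hw0 : w ≠ 0) :
    Module.finrank ℚ (Submodule.span ℚ (Set.range fun y : Y₀ => fun g : G => w (g • y))) = Module.finrank ℚ A := by
  rw [← finrank_span_translate_eq_finrank_span_shadowCoeff, span_translate_eq_of_irreducible hAst hirr hw hw0]

omit [Fintype Y₀] [DecidableEq Y₀] in
/-- `S(w) ≠ 0` iff `w ≠ 0` (the value at `g = 1` of the `y`-th coefficient is `w(y)`). [folklore] -/
theorem span_shadowCoeff_eq_bot_iff (w : Y₀ → ℚ) :
    Submodule.span ℚ (Set.range fun y : Y₀ => fun g : G => w (g • y)) = ⊥ ↔ w = 0 := by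
  constructor
  · intro h
    funext y
    have hmem : (fun g : G => w (g • y)) ∈ Submodule.span ℚ (Set.range fun y : Y₀ => fun g : G => w (g • y)) :=
      Submodule.subset_span ⟨y, rfl⟩
    rw [h, Submodule.mem_bot] at hmem
    simpa using congrFun hmem 1
  · rintro rfl
    rw [Submodule.span_eq_bot]
    rintro _ ⟨y, rfl⟩
    rfl

omit [Fintype Y₀] [DecidableEq Y₀] [DecidableEq Y₁] in
/-- **AN EQUIVARIANT MAP CARRYING `w₁` TO `w₀` GIVES `S(w₀) ≤ S(w₁)`**: if `L : ℚ^{Y₁} → ℚ^{Y₀}` is linear, commutes with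
the translations along the orbit of `w₁` and `L w₁ = w₀`, then every shadow coefficient of `w₀` is a fixed combination of
those of `w₁`: `w₀(g·y) = Σ_{y′} L(δ_{y′})(y) · w₁(g·y′)`. [cite: Gordon1999HodgeAVSurvey, §3 Theorem (proof)] -/
theorem span_shadowCoeff_le_of_map (L : (Y₁ → ℚ) →ₗ[ℚ] (Y₀ → ℚ)) {w₀ : Y₀ → ℚ} {w₁ : Y₁ → ℚ}
    (hL : ∀ k : G, L (fun y => w₁ (k • y)) = fun y => L w₁ (k • y)) (hLw : L w₁ = w₀) :
    Submodule.span ℚ (Set.range fun y : Y₀ => fun g : G => w₀ (g • y)) ≤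
      Submodule.span ℚ (Set.range fun y : Y₁ => fun g : G => w₁ (g • y)) := by
  rw [Submodule.span_le]
  rintro _ ⟨y, rfl⟩
  have hexp : (fun g : G => w₀ (g • y)) =
      ∑ y' : Y₁, L (Pi.single y' 1) y • fun g : G => w₁ (g • y') := by
    funext g
    rw [← hLw, ← congrFun (hL g) y]
    have hdec : (fun y₁ : Y₁ => w₁ (g • y₁)) = ∑ y' : Y₁, w₁ (g • y') • (Pi.single y' (1 : ℚ) : Y₁ → ℚ) := by
      funext y₁
      simp [Finset.sum_apply, Pi.single_apply]
    rw [hdec, map_sum]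
    simp [Finset.sum_apply, map_smul, mul_comm]
  show (fun g : G => w₀ (g • y)) ∈ _
  rw [hexp]
  exact Submodule.sum_mem _ fun y' _ => Submodule.smul_mem _ _ (Submodule.subset_span ⟨y', rfl⟩)

/-! ### §2 The meet theorem -/

omit [DecidableEq Y₀] [DecidableEq Y₁] in
/-- **THE MEET THEOREM.**  `A₀ ≤ ℚ^{Y₀}`, `A₁ ≤ ℚ^{Y₁}` stable and irreducible, `w_κ ∈ A_κ`.  If the shadow-coefficient
spaces MEET, `S(w₀) ∩ S(w₁) ≠ 0`, there is a linear `L : ℚ^{Y₁} → ℚ^{Y₀}` mapping `A₁` into `A₀`, injective and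
EQUIVARIANT on `A₁`, with `L w₁ = w₀`.  (The images of `A₀`, `A₁` under the coefficient maps `Θ_κ` attached to a common
element are irreducible submodules of `ℚ^G` with a common non-zero vector, hence equal; `L = Θ₀⁻¹ ∘ Θ₁` on `A₁`.)
[cite: Serre1977, §2.2 and §2.6] [cite: Lang2002, XVII §1 Prop. 1.1] -/
theorem exists_map_of_span_shadowCoeff_inf_ne_bot {A₀ : Submodule ℚ (Y₀ → ℚ)} {A₁ : Submodule ℚ (Y₁ → ℚ)}
    (hAst₀ : ∀ (k : G) (a : Y₀ → ℚ), a ∈ A₀ → (fun y => a (k • y)) ∈ A₀)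
    (hirr₀ : ∀ W : Submodule ℚ (Y₀ → ℚ), W ≤ A₀ → W ≠ ⊥ →
      (∀ (k : G) (f : Y₀ → ℚ), f ∈ W → (fun y => f (k • y)) ∈ W) → W = A₀)
    (hAst₁ : ∀ (k : G) (a : Y₁ → ℚ), a ∈ A₁ → (fun y => a (k • y)) ∈ A₁)
    (hirr₁ : ∀ W : Submodule ℚ (Y₁ → ℚ), W ≤ A₁ → W ≠ ⊥ →
      (∀ (k : G) (f : Y₁ → ℚ), f ∈ W → (fun y => f (k • y)) ∈ W) → W = A₁)
    {w₀ : Y₀ → ℚ} {w₁ : Y₁ → ℚ} (hw₀ : w₀ ∈ A₀) (hw₁ : w₁ ∈ A₁)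
    (hne : Submodule.span ℚ (Set.range fun y : Y₀ => fun g : G => w₀ (g • y)) ⊓
      Submodule.span ℚ (Set.range fun y : Y₁ => fun g : G => w₁ (g • y)) ≠ ⊥) :
    ∃ L : (Y₁ → ℚ) →ₗ[ℚ] (Y₀ → ℚ), (∀ f ∈ A₁, L f ∈ A₀) ∧ (∀ f ∈ A₁, L f = 0 → f = 0) ∧
      (∀ (k : G) (f : Y₁ → ℚ), f ∈ A₁ → L (fun y => f (k • y)) = fun y => L f (k • y)) ∧ L w₁ = w₀ := by
  obtain ⟨c, ⟨hc₀, hc₁⟩, hc⟩ := (Submodule.ne_bot_iff _).1 hne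
  obtain ⟨α, hα⟩ := (Submodule.mem_span_range_iff_exists_fun ℚ).1 hc₀
  obtain ⟨β, hβ⟩ := (Submodule.mem_span_range_iff_exists_fun ℚ).1 hc₁
  -- the coefficient maps `Θ₀ f = (g ↦ Σ_y α y · f(g·y))`, `Θ₁ f = (g ↦ Σ_y β y · f(g·y))`
  let Θ₀ : (Y₀ → ℚ) →ₗ[ℚ] (G → ℚ) :=
    { toFun := fun f g => ∑ y, α y * f (g • y)
      map_add' := fun f f' => by
        funext g
        simp only [Pi.add_apply, mul_add, Finset.sum_add_distrib]
      map_smul' := fun t f => by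
        funext g
        simp only [Pi.smul_apply, smul_eq_mul, RingHom.id_apply, Finset.mul_sum, mul_left_comm] }
  let Θ₁ : (Y₁ → ℚ) →ₗ[ℚ] (G → ℚ) :=
    { toFun := fun f g => ∑ y, β y * f (g • y)
      map_add' := fun f f' => by
        funext g
        simp only [Pi.add_apply, mul_add, Finset.sum_add_distrib]
      map_smul' := fun t f => by
        funext g
        simp only [Pi.smul_apply, smul_eq_mul, RingHom.id_apply, Finset.mul_sum, mul_left_comm] }
  have hΘ₀_apply : ∀ (f : Y₀ → ℚ) (g : G), Θ₀ f g = ∑ y, α y * f (g • y) := fun f g => rfl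
  have hΘ₁_apply : ∀ (f : Y₁ → ℚ) (g : G), Θ₁ f g = ∑ y, β y * f (g • y) := fun f g => rfl
  have hΘ₀w : Θ₀ w₀ = c := by
    rw [← hα]; funext g; rw [hΘ₀_apply]; simp [Finset.sum_apply, Pi.smul_apply, smul_eq_mul]
  have hΘ₁w : Θ₁ w₁ = c := by
    rw [← hβ]; funext g; rw [hΘ₁_apply]; simp [Finset.sum_apply, Pi.smul_apply, smul_eq_mul]
  -- equivariance of the coefficient maps: translation by `k` becomes left translation on `G`
  have hΘ₀eq : ∀ (k : G) (f : Y₀ → ℚ), Θ₀ (fun y => f (k • y)) = fun g => Θ₀ f (k * g) := fun k f => by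
    funext g; rw [hΘ₀_apply, hΘ₀_apply]; simp [mul_smul]
  have hΘ₁eq : ∀ (k : G) (f : Y₁ → ℚ), Θ₁ (fun y => f (k • y)) = fun g => Θ₁ f (k * g) := fun k f => by
    funext g; rw [hΘ₁_apply, hΘ₁_apply]; simp [mul_smul]
  -- injectivity on `A_κ` by irreducibility (the kernel is a stable proper subspace of `A_κ`)
  have hinj₀ : ∀ f ∈ A₀, Θ₀ f = 0 → f = 0 := by
    intro f hf hf0
    by_contra hf_ne
    have hW : LinearMap.ker Θ₀ ⊓ A₀ = A₀ := hirr₀ _ inf_le_right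
      (fun h => hf_ne (by
        have hmem : f ∈ LinearMap.ker Θ₀ ⊓ A₀ := ⟨LinearMap.mem_ker.2 hf0, hf⟩
        rw [h] at hmem
        exact (Submodule.mem_bot ℚ).1 hmem))
      (fun k f' hf' => ⟨by
        change Θ₀ (fun y => f' (k • y)) = 0
        rw [hΘ₀eq, LinearMap.mem_ker.1 hf'.1]; rfl, hAst₀ k f' hf'.2⟩)
    have hw : w₀ ∈ LinearMap.ker Θ₀ ⊓ A₀ := by rw [hW]; exact hw₀
    exact hc (by rw [← hΘ₀w]; exact LinearMap.mem_ker.1 hw.1)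
  have hinj₁ : ∀ f ∈ A₁, Θ₁ f = 0 → f = 0 := by
    intro f hf hf0
    by_contra hf_ne
    have hW : LinearMap.ker Θ₁ ⊓ A₁ = A₁ := hirr₁ _ inf_le_right
      (fun h => hf_ne (by
        have hmem : f ∈ LinearMap.ker Θ₁ ⊓ A₁ := ⟨LinearMap.mem_ker.2 hf0, hf⟩
        rw [h] at hmem
        exact (Submodule.mem_bot ℚ).1 hmem))
      (fun k f' hf' => ⟨by
        change Θ₁ (fun y => f' (k • y)) = 0
        rw [hΘ₁eq, LinearMap.mem_ker.1 hf'.1]; rfl, hAst₁ k f' hf'.2⟩)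
    have hw : w₁ ∈ LinearMap.ker Θ₁ ⊓ A₁ := by rw [hW]; exact hw₁
    exact hc (by rw [← hΘ₁w]; exact LinearMap.mem_ker.1 hw.1)
  have hw₁0 : w₁ ≠ 0 := fun h => hc (by rw [← hΘ₁w, h, map_zero])
  -- the image of `A₀` is stable under left translation
  have hM₀st : ∀ (k : G) (x : G → ℚ), x ∈ A₀.map Θ₀ → (fun g => x (k * g)) ∈ A₀.map Θ₀ := by
    rintro k _ ⟨a, ha, rfl⟩
    exact ⟨fun y => a (k • y), hAst₀ k a ha, hΘ₀eq k a⟩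
  have hM₁st : ∀ (k : G) (x : G → ℚ), x ∈ A₁.map Θ₁ → (fun g => x (k * g)) ∈ A₁.map Θ₁ := by
    rintro k _ ⟨a, ha, rfl⟩
    exact ⟨fun y => a (k • y), hAst₁ k a ha, hΘ₁eq k a⟩
  -- `Θ₁(A₁) ≤ Θ₀(A₀)`: the preimage in `A₁` of the meet of the two images is stable and non-zero, hence all of `A₁`
  have hM₁le : A₁.map Θ₁ ≤ A₀.map Θ₀ := by
    have hcmem : c ∈ A₀.map Θ₀ ⊓ A₁.map Θ₁ := ⟨⟨w₀, hw₀, hΘ₀w⟩, ⟨w₁, hw₁, hΘ₁w⟩⟩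
    have hN : (A₀.map Θ₀ ⊓ A₁.map Θ₁).comap Θ₁ ⊓ A₁ = A₁ := hirr₁ _ inf_le_right
      (fun h => hw₁0 (by
        have hmem : w₁ ∈ (A₀.map Θ₀ ⊓ A₁.map Θ₁).comap Θ₁ ⊓ A₁ :=
          ⟨Submodule.mem_comap.2 (by rw [hΘ₁w]; exact hcmem), hw₁⟩
        rw [h] at hmem
        exact (Submodule.mem_bot ℚ).1 hmem))
      (fun k f hf => ⟨Submodule.mem_comap.2 (by
          rw [hΘ₁eq]
          have hfm : Θ₁ f ∈ A₀.map Θ₀ ⊓ A₁.map Θ₁ := Submodule.mem_comap.1 hf.1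
          exact ⟨hM₀st k _ hfm.1, hM₁st k _ hfm.2⟩), hAst₁ k f hf.2⟩)
    rintro _ ⟨f, hf, rfl⟩
    have hf' : f ∈ (A₀.map Θ₀ ⊓ A₁.map Θ₁).comap Θ₁ ⊓ A₁ := by rw [hN]; exact hf
    exact (Submodule.mem_comap.1 hf'.1).1
  -- `Θ₀|_{A₀}` is injective; invert it on its range, which contains `Θ₁(A₁)`
  have hinj₀' : Function.Injective (Θ₀.domRestrict A₀) := by
    intro a b hab
    apply Subtype.ext
    have hsub : Θ₀ ((a : Y₀ → ℚ) - b) = 0 := by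
      rw [map_sub, sub_eq_zero]
      exact hab
    exact sub_eq_zero.1 (hinj₀ _ (A₀.sub_mem a.2 b.2) hsub)
  have hmem : ∀ f : A₁, Θ₁.domRestrict A₁ f ∈ LinearMap.range (Θ₀.domRestrict A₀) := fun f => by
    rw [LinearMap.range_domRestrict]
    exact hM₁le ⟨f, f.2, rfl⟩
  obtain ⟨L, hL⟩ := LinearMap.exists_extend
    (A₀.subtype ∘ₗ (LinearEquiv.ofInjective (Θ₀.domRestrict A₀) hinj₀').symm.toLinearMap ∘ₗ
      LinearMap.codRestrict (LinearMap.range (Θ₀.domRestrict A₀)) (Θ₁.domRestrict A₁) hmem)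
  -- on `A₁`: `L f ∈ A₀` and `Θ₀ (L f) = Θ₁ f`
  have hLf : ∀ f ∈ A₁, L f ∈ A₀ ∧ Θ₀ (L f) = Θ₁ f := by
    intro f hf
    have h1 := LinearMap.congr_fun hL ⟨f, hf⟩
    simp only [LinearMap.coe_comp, Function.comp_apply, Submodule.coe_subtype, LinearEquiv.coe_coe] at h1
    refine ⟨by rw [h1]; exact Submodule.coe_mem _, ?_⟩
    have h2 := LinearEquiv.ofInjective_symm_apply (Θ₀.domRestrict A₀) (h := hinj₀')
      (LinearMap.codRestrict (LinearMap.range (Θ₀.domRestrict A₀)) (Θ₁.domRestrict A₁) hmem ⟨f, hf⟩)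
    rw [LinearMap.domRestrict_apply] at h2
    rw [h1, h2]
    rfl
  refine ⟨L, fun f hf => (hLf f hf).1, fun f hf hLf0 => hinj₁ f hf (by rw [← (hLf f hf).2, hLf0, map_zero]),
    fun k f hf => ?_, ?_⟩
  · -- equivariance on `A₁`: both sides lie in `A₀` and have the same image under `Θ₀`
    have hfk : (fun y => f (k • y)) ∈ A₁ := hAst₁ k f hf
    have hdiff := hinj₀ (L (fun y => f (k • y)) - fun y => L f (k • y))
      (A₀.sub_mem (hLf _ hfk).1 (hAst₀ k _ (hLf f hf).1)) (by
        rw [map_sub, (hLf _ hfk).2, hΘ₁eq, hΘ₀eq, (hLf f hf).2, sub_self])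
    exact sub_eq_zero.1 hdiff
  · have hdiff := hinj₀ (L w₁ - w₀) (A₀.sub_mem (hLf w₁ hw₁).1 hw₀)
      (by rw [map_sub, (hLf w₁ hw₁).2, hΘ₁w, hΘ₀w, sub_self])
    exact sub_eq_zero.1 hdiff

omit [DecidableEq Y₀] [DecidableEq Y₁] in
/-- **THE SHADOW DICHOTOMY**: for shadows in stable irreducible modules, `S(w₀) ∩ S(w₁) = 0` or `S(w₀) = S(w₁)`.
[cite: Serre1977, §2.2 and §2.6] -/
theorem span_shadowCoeff_inf_eq_bot_or_eq {A₀ : Submodule ℚ (Y₀ → ℚ)} {A₁ : Submodule ℚ (Y₁ → ℚ)}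
    (hAst₀ : ∀ (k : G) (a : Y₀ → ℚ), a ∈ A₀ → (fun y => a (k • y)) ∈ A₀)
    (hirr₀ : ∀ W : Submodule ℚ (Y₀ → ℚ), W ≤ A₀ → W ≠ ⊥ →
      (∀ (k : G) (f : Y₀ → ℚ), f ∈ W → (fun y => f (k • y)) ∈ W) → W = A₀)
    (hAst₁ : ∀ (k : G) (a : Y₁ → ℚ), a ∈ A₁ → (fun y => a (k • y)) ∈ A₁)
    (hirr₁ : ∀ W : Submodule ℚ (Y₁ → ℚ), W ≤ A₁ → W ≠ ⊥ →
      (∀ (k : G) (f : Y₁ → ℚ), f ∈ W → (fun y => f (k • y)) ∈ W) → W = A₁)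
    {w₀ : Y₀ → ℚ} {w₁ : Y₁ → ℚ} (hw₀ : w₀ ∈ A₀) (hw₁ : w₁ ∈ A₁) :
    Submodule.span ℚ (Set.range fun y : Y₀ => fun g : G => w₀ (g • y)) ⊓
        Submodule.span ℚ (Set.range fun y : Y₁ => fun g : G => w₁ (g • y)) = ⊥ ∨
      Submodule.span ℚ (Set.range fun y : Y₀ => fun g : G => w₀ (g • y)) =
        Submodule.span ℚ (Set.range fun y : Y₁ => fun g : G => w₁ (g • y)) := by
  by_cases h : Submodule.span ℚ (Set.range fun y : Y₀ => fun g : G => w₀ (g • y)) ⊓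
      Submodule.span ℚ (Set.range fun y : Y₁ => fun g : G => w₁ (g • y)) = ⊥
  · exact Or.inl h
  · right
    obtain ⟨L, -, -, hLeq, hLw⟩ := exists_map_of_span_shadowCoeff_inf_ne_bot hAst₀ hirr₀ hAst₁ hirr₁ hw₀ hw₁ h
    obtain ⟨L', -, -, hLeq', hLw'⟩ :=
      exists_map_of_span_shadowCoeff_inf_ne_bot hAst₁ hirr₁ hAst₀ hirr₀ hw₁ hw₀ (by rwa [inf_comm])
    exact le_antisymm (span_shadowCoeff_le_of_map L (fun k => hLeq k w₁ hw₁) hLw)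
      (span_shadowCoeff_le_of_map L' (fun k => hLeq' k w₀ hw₀) hLw')

omit [DecidableEq Y₀] [DecidableEq Y₁] in
/-- **CRITERION**: `S(w₀) ∩ S(w₁) ≠ 0` IFF `w₀ ≠ 0` and an equivariant `L : ℚ^{Y₁} → ℚ^{Y₀}`, injective on `A₁` with
`L(A₁) ⊆ A₀`, carries `w₁` to `w₀` — gen 55's criterion for two slots with one common irreducible module, now for two
different pivots. [cite: Serre1977, §2.2] [cite: Gordon1999HodgeAVSurvey, §3 Theorem] -/
theorem span_shadowCoeff_inf_ne_bot_iff {A₀ : Submodule ℚ (Y₀ → ℚ)} {A₁ : Submodule ℚ (Y₁ → ℚ)}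
    (hAst₀ : ∀ (k : G) (a : Y₀ → ℚ), a ∈ A₀ → (fun y => a (k • y)) ∈ A₀)
    (hirr₀ : ∀ W : Submodule ℚ (Y₀ → ℚ), W ≤ A₀ → W ≠ ⊥ →
      (∀ (k : G) (f : Y₀ → ℚ), f ∈ W → (fun y => f (k • y)) ∈ W) → W = A₀)
    (hAst₁ : ∀ (k : G) (a : Y₁ → ℚ), a ∈ A₁ → (fun y => a (k • y)) ∈ A₁)
    (hirr₁ : ∀ W : Submodule ℚ (Y₁ → ℚ), W ≤ A₁ → W ≠ ⊥ →
      (∀ (k : G) (f : Y₁ → ℚ), f ∈ W → (fun y => f (k • y)) ∈ W) → W = A₁)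
    {w₀ : Y₀ → ℚ} {w₁ : Y₁ → ℚ} (hw₀ : w₀ ∈ A₀) (hw₁ : w₁ ∈ A₁) :
    Submodule.span ℚ (Set.range fun y : Y₀ => fun g : G => w₀ (g • y)) ⊓
        Submodule.span ℚ (Set.range fun y : Y₁ => fun g : G => w₁ (g • y)) ≠ ⊥ ↔
      w₀ ≠ 0 ∧ ∃ L : (Y₁ → ℚ) →ₗ[ℚ] (Y₀ → ℚ), (∀ f ∈ A₁, L f ∈ A₀) ∧ (∀ f ∈ A₁, L f = 0 → f = 0) ∧
        (∀ (k : G) (f : Y₁ → ℚ), f ∈ A₁ → L (fun y => f (k • y)) = fun y => L f (k • y)) ∧ L w₁ = w₀ := by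
  constructor
  · intro h
    refine ⟨fun hw => h ?_, exists_map_of_span_shadowCoeff_inf_ne_bot hAst₀ hirr₀ hAst₁ hirr₁ hw₀ hw₁ h⟩
    rw [(span_shadowCoeff_eq_bot_iff (G := G) w₀).2 hw, bot_inf_eq]
  · rintro ⟨hw, L, -, -, hLeq, hLw⟩ h
    have hle := span_shadowCoeff_le_of_map L (fun k => hLeq k w₁ hw₁) hLw
    apply hw
    rw [← span_shadowCoeff_eq_bot_iff (G := G) w₀]
    exact le_bot_iff.1 ((le_inf le_rfl hle).trans h.le)

omit [DecidableEq Y₀] [DecidableEq Y₁] in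
/-- **QUANTISATION: `dim(S(w₀) ∩ S(w₁)) ∈ {0, dim A₀}`.** [cite: Serre1977, §2.2 and §2.6] -/
theorem finrank_span_shadowCoeff_inf_eq_zero_or_eq {A₀ : Submodule ℚ (Y₀ → ℚ)} {A₁ : Submodule ℚ (Y₁ → ℚ)}
    (hAst₀ : ∀ (k : G) (a : Y₀ → ℚ), a ∈ A₀ → (fun y => a (k • y)) ∈ A₀)
    (hirr₀ : ∀ W : Submodule ℚ (Y₀ → ℚ), W ≤ A₀ → W ≠ ⊥ →
      (∀ (k : G) (f : Y₀ → ℚ), f ∈ W → (fun y => f (k • y)) ∈ W) → W = A₀)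
    (hAst₁ : ∀ (k : G) (a : Y₁ → ℚ), a ∈ A₁ → (fun y => a (k • y)) ∈ A₁)
    (hirr₁ : ∀ W : Submodule ℚ (Y₁ → ℚ), W ≤ A₁ → W ≠ ⊥ →
      (∀ (k : G) (f : Y₁ → ℚ), f ∈ W → (fun y => f (k • y)) ∈ W) → W = A₁)
    {w₀ : Y₀ → ℚ} {w₁ : Y₁ → ℚ} (hw₀ : w₀ ∈ A₀) (hw₁ : w₁ ∈ A₁) :
    Module.finrank ℚ (Submodule.span ℚ (Set.range fun y : Y₀ => fun g : G => w₀ (g • y)) ⊓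
        Submodule.span ℚ (Set.range fun y : Y₁ => fun g : G => w₁ (g • y)) : Submodule ℚ (G → ℚ)) = 0 ∨
      Module.finrank ℚ (Submodule.span ℚ (Set.range fun y : Y₀ => fun g : G => w₀ (g • y)) ⊓
        Submodule.span ℚ (Set.range fun y : Y₁ => fun g : G => w₁ (g • y)) : Submodule ℚ (G → ℚ)) =
        Module.finrank ℚ A₀ := by
  rcases span_shadowCoeff_inf_eq_bot_or_eq hAst₀ hirr₀ hAst₁ hirr₁ hw₀ hw₁ with h | h
  · left
    rw [h, finrank_bot]
  · by_cases hw : w₀ = 0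
    · left
      rw [(span_shadowCoeff_eq_bot_iff (G := G) w₀).2 hw, bot_inf_eq, finrank_bot]
    · right
      rw [← h, inf_idem, finrank_span_shadowCoeff_eq_of_irreducible hAst₀ hirr₀ hw₀ hw]

omit [DecidableEq Y₀] [DecidableEq Y₁] in
/-- **A NON-ZERO MEET FORCES `dim A₀ = dim A₁`** (the equivariant `L` is an isomorphism `A₁ ≅ A₀`).
[cite: Serre1977, §2.2] [cite: Lang2002, XVII §1 Prop. 1.1] -/
theorem finrank_eq_finrank_of_span_shadowCoeff_inf_ne_bot {A₀ : Submodule ℚ (Y₀ → ℚ)} {A₁ : Submodule ℚ (Y₁ → ℚ)}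
    (hAst₀ : ∀ (k : G) (a : Y₀ → ℚ), a ∈ A₀ → (fun y => a (k • y)) ∈ A₀)
    (hirr₀ : ∀ W : Submodule ℚ (Y₀ → ℚ), W ≤ A₀ → W ≠ ⊥ →
      (∀ (k : G) (f : Y₀ → ℚ), f ∈ W → (fun y => f (k • y)) ∈ W) → W = A₀)
    (hAst₁ : ∀ (k : G) (a : Y₁ → ℚ), a ∈ A₁ → (fun y => a (k • y)) ∈ A₁)
    (hirr₁ : ∀ W : Submodule ℚ (Y₁ → ℚ), W ≤ A₁ → W ≠ ⊥ →
      (∀ (k : G) (f : Y₁ → ℚ), f ∈ W → (fun y => f (k • y)) ∈ W) → W = A₁)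
    {w₀ : Y₀ → ℚ} {w₁ : Y₁ → ℚ} (hw₀ : w₀ ∈ A₀) (hw₁ : w₁ ∈ A₁)
    (hne : Submodule.span ℚ (Set.range fun y : Y₀ => fun g : G => w₀ (g • y)) ⊓
      Submodule.span ℚ (Set.range fun y : Y₁ => fun g : G => w₁ (g • y)) ≠ ⊥) :
    Module.finrank ℚ A₀ = Module.finrank ℚ A₁ := by
  have hw₀0 : w₀ ≠ 0 := fun hw => hne (by rw [(span_shadowCoeff_eq_bot_iff (G := G) w₀).2 hw, bot_inf_eq])
  have hw₁0 : w₁ ≠ 0 := fun hw => hne (by rw [(span_shadowCoeff_eq_bot_iff (G := G) w₁).2 hw, inf_bot_eq])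
  rcases span_shadowCoeff_inf_eq_bot_or_eq hAst₀ hirr₀ hAst₁ hirr₁ hw₀ hw₁ with h | h
  · exact absurd h hne
  · rw [← finrank_span_shadowCoeff_eq_of_irreducible hAst₀ hirr₀ hw₀ hw₀0,
      ← finrank_span_shadowCoeff_eq_of_irreducible hAst₁ hirr₁ hw₁ hw₁0, h]

end Summit.HodgeConjecture.CorCM.IrrOdd

end
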